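import Summits.AtomisticToContinuum.Crystallization.Theorems.LoopTunnelDialForcePricingCert
import Literature.Computation.Certificates.BoxCoveringByCells

/-!
# LoopTunnelDial — FORCE PRICING kit 15 «FRAME»: isometry transport, the one-frame reduction, the `a`-box reduction

Crux `T = LoopTunnelDial.PocketCase` (stmt-AtomisticToContinuum-27294), stub 3 `HOT = ContactHotAbove (3/4)`.  Kit 14 PROVED
`HOT ⟸ FinPricedLoadCap (3/4) (8/125) (77/20) 5 ⟸ (∀ pairs (x,q), a valid CellCert for −pricedTerm with bound ≤ 77/20)` (modulo `e⋆ ≤ −0.711`).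
This file removes the two universally quantified POINTS `x q : ℝ³` from what census must certify (critic row 367 (4)(a)–(c)):

* §6 (a) ISOMETRY INVARIANCE: `pricedTerm c x q z` is a function of the three pairwise distances only (polarisation
  `⟪x − z, q − x⟫ = (|q − z|² − |x − q|² − |x − z|²)/2`, no appeal to Mazur–Ulam), hence invariant under every isometry; `Admissible` likewise;
  a certificate is transported along a map INTO its frame by pulling its cells back (`CellCert.comap`, bound unchanged, `Valid` preserved).
* §7 (b) THE FRAME: for every pair `(x, q)` an isometry `ψ` of `ℝ³` with `ψ x = 0`, `ψ q = |x − q|·e₃` (translation, then the Householder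
  reflection swapping `q − x` and `|q − x|·e₃`, `Submodule.reflection_sub`).  Hence
  `(∀ a ∈ [7/10, ρ), ∃ C valid at (0, a·e₃)) → FinPricedLoadCap ρ c Λ R` (`finPricedLoadCap_of_frame_certs`).
* §8 (c) THE a-BOX: in the frame the weight is `frameWeight c a z = −V(|z|) − c·a·g(|z|)·z₂/|z|`, AFFINE in `a`, and `dist (a·e₃) z` is convex in
  `a`; so ONE certificate whose majorants hold at both ends `a₁, a₂` and whose cover uses the exclusion `|z − a·e₃| < 7/10` only when it holds at
  both ends (`CellCert.BoxValid`) is valid for every `a ∈ [a₁, a₂]`; finitely many a-boxes `b 0 ≤ 7/10 < … < 3/4 ≤ b m` give `FinPricedLoadCap`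
  and `HOT` (`contactHotAbove_threeQuarters_of_boxCerts5`: the statement census's TAG 129′(δ) output must meet, numerals (8/125, 77/20, 5) of kit 14).

The generic checker ROWS for rational boxes (C1 grid cover + exclusion, the C2 interval rows, the C3 mesh row) and the censored GRID certificate are
in `LoopTunnelDialForcePricingFrameRows.lean`; the sharp joint C2 row of record and the toys replayed end to end ((4)(d)) in
`LoopTunnelDialForcePricingFrameSharp.lean`.  0 sorry; axioms standard.

presearch (critic row 367, mandatory): «a per-site force-balance Lagrange multiplier (signed axial price `c·forceTerm`) combined with an LP-dual
clique/cell certificate for a one-centre weighted hard-core bound» → none in print (queries, corpus fts+vec AND galaxy: corpus hybrid "Lennard-Jones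
cluster minimum interatomic distance lower bound" → textbook hits only; corpus fts → [corpus:paper:doi-10-1007-s10898-007-9151-3 p.2–4] Vinkó–Neumaier
2007 = zero-order site-energy / shell-packing bounds for Morse clusters, no force balance, no dual certificate; vsearch prose → none relevant;
[galaxy:all] "minimal interatomic distance|minimum inter-particle distance|minimal inter-particle distance" → 0 relevant of 23; [galaxy:pdf] "distance
in Lennard-Jones cluster|Interatomic Distance in Lennard|Minimizers of Lennard-Jones Clusters" → 0; crossref/arXiv: Xue 1997 doi:10.1023/a:1008284629099,
Blanc 2004 doi:10.1023/b:coap.0000039486.97389.87, Schachinger–Addis–Bomze–Schoen 2007, Kiessling–Wales 2025 arXiv:2511.15008 (read pp.2,5,8: a GLOBAL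
virial identity, best rigorous minimal distance 0.7677σ, conjectured > σ·(…)) — all zero-order shell capacities or global identities; the signed
per-site directional multiplier with a cell/clique LP dual is not in those papers) — confirms the critic's reading; nothing to cite beyond kit 14's keys.
-/

noncomputable section

namespace Summit.AtomisticToContinuum.Crystallization.Theorems.LoopTunnelDialForcePricing

open scoped BigOperators Classical InnerProductSpace
open Literature.MathematicalPhysics.StatisticalMechanics
open Summit.AtomisticToContinuum.Crystallization.Theorems.GrainPercolationDialCrossCeiling (E3)
open Summit.AtomisticToContinuum.Crystallization.Theorems.ChargedEnergyGapNegative (eStar)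
open Summit.AtomisticToContinuum.Crystallization.Theorems.LoopTunnelDialContactLaw
open Summit.AtomisticToContinuum.Crystallization.Theorems.LoopTunnelDialRangeTails

/-! ### §6 (a) Distance form of the priced weight; isometry invariance; transport of certificates (PROVED) -/

/-- Polarisation: `⟪x − z, q − x⟫ = (|q − z|² − |x − q|² − |x − z|²)/2`. -/
theorem inner_sub_sub_eq_dist (x q z : E3) :
    ⟪x - z, q - x⟫_ℝ = (dist q z ^ 2 - dist x q ^ 2 - dist x z ^ 2) / 2 := by
  have h : q - z = (q - x) + (x - z) := by abel
  simp only [dist_eq_norm]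
  rw [h, norm_add_sq_real, real_inner_comm, norm_sub_rev x q]
  ring

/-- The priced weight as a function of the three distances `d = |x − z|`, `a = |x − q|`, `e = |q − z|`. [line vocabulary · LoopTunnelDial contact dial · crux stmt-AtomisticToContinuum-27294 · definition, not a cited fact] -/
def pricedOfDist (c d a e : ℝ) : ℝ :=
  lennardJones d + c * (-(1 / 12) * (12 * d⁻¹ ^ 13 - 12 * d⁻¹ ^ 7) * ((e ^ 2 - a ^ 2 - d ^ 2) / 2 / d))

/-- **DISTANCE FORM (PROVED):** `pricedTerm c x q z` depends on `(x, q, z)` only through the three pairwise distances. -/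
theorem pricedTerm_eq_dist (c : ℝ) (x q z : E3) :
    pricedTerm c x q z = pricedOfDist c (dist x z) (dist x q) (dist q z) := by
  unfold pricedTerm forceTerm pricedOfDist
  rw [inner_sub_sub_eq_dist]

/-- **ISOMETRY INVARIANCE of the priced weight (PROVED).** -/
theorem pricedTerm_isometry {φ : E3 → E3} (hφ : Isometry φ) (c : ℝ) (x q z : E3) :
    pricedTerm c (φ x) (φ q) (φ z) = pricedTerm c x q z := by
  rw [pricedTerm_eq_dist, pricedTerm_eq_dist, hφ.dist_eq, hφ.dist_eq, hφ.dist_eq]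

/-- Isometry invariance of the admissible region. -/
theorem admissible_isometry_iff {φ : E3 → E3} (hφ : Isometry φ) {x q : E3} {R : ℝ} {z : E3} :
    Admissible (φ x) (φ q) R (φ z) ↔ Admissible x q R z := by
  unfold Admissible
  rw [hφ.dist_eq, hφ.dist_eq]

/-- **TRANSPORT OF A CERTIFICATE along a map `ψ` INTO its frame:** the cells are pulled back, everything else is kept. [line vocabulary · LoopTunnelDial contact dial · crux stmt-AtomisticToContinuum-27294 · definition, not a cited fact] -/
def CellCert.comap (C : CellCert) (ψ : E3 → E3) : CellCert :=
  ⟨C.cells, fun i => ψ ⁻¹' C.cell i, C.wt, C.cliques, C.y⟩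

/-- Transport along `ψ` does not change a certificate's bound. -/
@[simp] theorem CellCert.comap_bound (C : CellCert) (ψ : E3 → E3) : (C.comap ψ).bound = C.bound := rfl

/-- **TRANSPORTED CERTIFICATES STAY VALID (PROVED):** if `C` is valid about `(x₀, q₀)` for `w₀` and `ψ` is an isometry with `ψ x = x₀`,
`ψ q = q₀`, then `C.comap ψ` is valid about `(x, q)` for every weight `w` that agrees with `w₀ ∘ ψ` on the admissible region. -/
theorem CellCert.Valid.comap {C : CellCert} {x₀ q₀ : E3} {R : ℝ} {w₀ : E3 → ℝ} (hV : C.Valid x₀ q₀ R w₀)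
    {ψ : E3 → E3} (hψ : Isometry ψ) {x q : E3} (hx : ψ x = x₀) (hq : ψ q = q₀) {w : E3 → ℝ}
    (hw : ∀ z, Admissible x q R z → w z = w₀ (ψ z)) :
    (C.comap ψ).Valid x q R w := by
  obtain ⟨hcover, hwt, hcl, hdual, hy⟩ := hV
  have hadm : ∀ z, Admissible x q R z → Admissible x₀ q₀ R (ψ z) := by
    intro z hz
    rw [← hx, ← hq]
    exact (admissible_isometry_iff hψ).2 hz
  refine ⟨?_, ?_, ?_, hdual, hy⟩
  · intro z hz
    obtain ⟨i, hi, hzi⟩ := hcover (ψ z) (hadm z hz)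
    exact ⟨i, hi, hzi⟩
  · intro i hi z hzi hz
    rw [hw z hz]
    exact hwt i hi (ψ z) hzi (hadm z hz)
  · intro K hK i hi j hj z hz z' hz'
    have := hcl K hK i hi j hj (ψ z) hz (ψ z') hz'
    rwa [hψ.dist_eq] at this

/-! ### §7 (b) The frame `x = 0`, `q = a·e₃` and the ONE-FRAME REDUCTION (PROVED) -/

/-- The axis vector `e₃ = (0, 0, 1)`. [line vocabulary · LoopTunnelDial contact dial · crux stmt-AtomisticToContinuum-27294 · definition, not a cited fact] -/
def e₃ : E3 := EuclideanSpace.single (2 : Fin 3) (1 : ℝ)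

/-- `‖e₃‖ = 1`. -/
@[simp] theorem norm_e₃ : ‖e₃‖ = 1 := by
  simp [e₃]

/-- `e₃ 2 = 1`. -/
@[simp] theorem e₃_apply_two : e₃ 2 = 1 := by simp [e₃]
/-- `e₃ 0 = 0`. -/
@[simp] theorem e₃_apply_zero : e₃ 0 = 0 := by simp [e₃]
/-- `e₃ 1 = 0`. -/
@[simp] theorem e₃_apply_one : e₃ 1 = 0 := by simp [e₃]

/-- `‖a • e₃‖ = |a|`. -/
theorem norm_smul_e₃ (a : ℝ) : ‖a • e₃‖ = |a| := by
  rw [norm_smul, norm_e₃, mul_one, Real.norm_eq_abs]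

/-- **THE FRAME MAP EXISTS (PROVED):** an isometry of `ℝ³` with `x ↦ 0` and `q ↦ |x − q|·e₃`. -/
theorem exists_isometry_frame (x q : E3) :
    ∃ ψ : E3 → E3, Isometry ψ ∧ ψ x = 0 ∧ ψ q = (dist x q) • e₃ := by
  have huv : ‖q - x‖ = ‖(dist x q) • e₃‖ := by
    rw [norm_smul_e₃, abs_of_nonneg dist_nonneg, dist_eq_norm, norm_sub_rev]
  refine ⟨fun z => ((ℝ ∙ ((q - x) - (dist x q) • e₃))ᗮ).reflection (z - x), ?_, by simp, ?_⟩
  · refine Isometry.of_dist_eq fun z z' => ?_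
    simp only [LinearIsometryEquiv.dist_map, dist_sub_right]
  · exact Submodule.reflection_sub huv

/-- **THE ONE-FRAME REDUCTION (PROVED):** certificates in the single frame `x = 0`, `q = a·e₃`, `7/10 ≤ a < ρ`, give `FinPricedLoadCap ρ c Λ R`. -/
theorem finPricedLoadCap_of_frame_certs {ρ c Λ R : ℝ}
    (h : ∀ a : ℝ, (7 : ℝ) / 10 ≤ a → a < ρ →
      ∃ C : CellCert, C.Valid 0 (a • e₃) R (fun z => -pricedTerm c 0 (a • e₃) z) ∧ C.bound ≤ Λ) :
    FinPricedLoadCap ρ c Λ R := by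
  refine finPricedLoadCap_of_certs fun x q h7 hρ => ?_
  obtain ⟨C, hV, hb⟩ := h (dist x q) h7 hρ
  obtain ⟨ψ, hψ, hx, hq⟩ := exists_isometry_frame x q
  refine ⟨C.comap ψ, hV.comap hψ hx hq fun z _ => ?_, by rw [CellCert.comap_bound]; exact hb⟩
  have key := pricedTerm_isometry hψ c x q z
  rw [hx, hq] at key
  show -pricedTerm c x q z = -pricedTerm c 0 (dist x q • e₃) (ψ z)
  rw [key]

/-- The one-frame reduction at the numerals of kit 14: `HOT` from frame certificates (modulo `e⋆ ≤ −0.711`). -/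
theorem contactHotAbove_threeQuarters_of_frameCerts5 (he : eStar ≤ -(711 / 1000))
    (h : ∀ a : ℝ, (7 : ℝ) / 10 ≤ a → a < 3 / 4 →
      ∃ C : CellCert, C.Valid 0 (a • e₃) 5 (fun z => -pricedTerm (8 / 125) 0 (a • e₃) z) ∧ C.bound ≤ 77 / 20) :
    ContactHotAbove (3 / 4) :=
  contactHotAbove_threeQuarters_of_finPriced5 he (finPricedLoadCap_of_frame_certs h)

/-! ### §8 (c) The frame weight, its affinity in `a`, and the a-BOX certificate (PROVED) -/

/-- **The FRAME WEIGHT** `frameWeight c a z = −V(|z|) − c·a·g(|z|)·z₂/|z|`, `g(r) = r⁻¹³ − r⁻⁷`: the negated priced weight in the frame. [line vocabulary · LoopTunnelDial contact dial · crux stmt-AtomisticToContinuum-27294 · definition, not a cited fact] -/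
def frameWeight (c a : ℝ) (z : E3) : ℝ :=
  -lennardJones ‖z‖ - c * a * ((‖z‖⁻¹ ^ 13 - ‖z‖⁻¹ ^ 7) * z 2 / ‖z‖)

/-- The frame inner product `⟪0 - z, a • e₃ - 0⟫ = -(a·z₂)`. -/
theorem inner_frame (a : ℝ) (z : E3) : ⟪(0 : E3) - z, a • e₃ - 0⟫_ℝ = -(a * z 2) := by
  rw [zero_sub, sub_zero, inner_neg_left, real_inner_smul_right, e₃, EuclideanSpace.inner_single_right]
  simp

/-- **FRAME IDENTITY (PROVED):** `−pricedTerm c 0 (a·e₃) z = frameWeight c a z`. -/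
theorem neg_pricedTerm_frame (c a : ℝ) (z : E3) : -pricedTerm c 0 (a • e₃) z = frameWeight c a z := by
  unfold pricedTerm forceTerm frameWeight
  rw [inner_frame, dist_zero_left]
  ring

/-- An affine function of `a ∈ [a₁, a₂]` is bounded by its larger endpoint value. -/
theorem affine_le_max {A B a a₁ a₂ : ℝ} (h₁ : a₁ ≤ a) (h₂ : a ≤ a₂) :
    A - B * a ≤ max (A - B * a₁) (A - B * a₂) := by
  rcases le_or_gt 0 B with hB | hB
  · exact le_max_of_le_left (by nlinarith)
  · exact le_max_of_le_right (by nlinarith)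

/-- The frame weight is AFFINE in `a`: on `[a₁, a₂]` it is majorised by its values at the ends. -/
theorem frameWeight_le_max {c a a₁ a₂ : ℝ} (h₁ : a₁ ≤ a) (h₂ : a ≤ a₂) (z : E3) :
    frameWeight c a z ≤ max (frameWeight c a₁ z) (frameWeight c a₂ z) := by
  have key : ∀ t : ℝ, frameWeight c t z =
      -lennardJones ‖z‖ - (c * ((‖z‖⁻¹ ^ 13 - ‖z‖⁻¹ ^ 7) * z 2 / ‖z‖)) * t := fun t => by
    unfold frameWeight; ring
  rw [key, key, key]
  exact affine_le_max h₁ h₂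

/-- `dist (a·e₃) z` is CONVEX in `a`: on `[a₁, a₂]` it is majorised by its values at the ends. -/
theorem dist_smul_e₃_le_max {a a₁ a₂ : ℝ} (h₁ : a₁ ≤ a) (h₂ : a ≤ a₂) (z : E3) :
    dist (a • e₃) z ≤ max (dist (a₁ • e₃) z) (dist (a₂ • e₃) z) := by
  rcases eq_or_lt_of_le (h₁.trans h₂) with h | h
  · have ha : a = a₁ := le_antisymm (h ▸ h₂) h₁
    rw [ha]
    exact le_max_left _ _
  · set t : ℝ := (a - a₁) / (a₂ - a₁) with ht
    have h21 : 0 < a₂ - a₁ := sub_pos.2 h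
    have h0 : 0 ≤ t := div_nonneg (sub_nonneg.2 h₁) h21.le
    have h1 : t ≤ 1 := (div_le_one h21).2 (sub_le_sub_right h₂ _)
    have hta : (1 - t) * a₁ + t * a₂ = a := by
      rw [ht]; field_simp; ring
    have hdec : a • e₃ - z = (1 - t) • (a₁ • e₃ - z) + t • (a₂ • e₃ - z) := by
      rw [← hta]; module
    rw [dist_eq_norm, dist_eq_norm, dist_eq_norm, hdec]
    have hA := le_max_left ‖a₁ • e₃ - z‖ ‖a₂ • e₃ - z‖
    have hB := le_max_right ‖a₁ • e₃ - z‖ ‖a₂ • e₃ - z‖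
    calc ‖(1 - t) • (a₁ • e₃ - z) + t • (a₂ • e₃ - z)‖
        ≤ ‖(1 - t) • (a₁ • e₃ - z)‖ + ‖t • (a₂ • e₃ - z)‖ := norm_add_le _ _
      _ = (1 - t) * ‖a₁ • e₃ - z‖ + t * ‖a₂ • e₃ - z‖ := by
          rw [norm_smul, norm_smul, Real.norm_of_nonneg h0, Real.norm_of_nonneg (sub_nonneg.2 h1)]
      _ ≤ max ‖a₁ • e₃ - z‖ ‖a₂ • e₃ - z‖ := by
          nlinarith [mul_nonneg (sub_nonneg.2 h1) (sub_nonneg.2 hA), mul_nonneg h0 (sub_nonneg.2 hB)]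

/-- **`CellCert.BoxValid C c a₁ a₂ R` — THE FIVE CHECKS FOR A WHOLE a-BOX** in the frame `x = 0`, `q = a·e₃`, `a ∈ [a₁, a₂]`:
C1box COVER of every `z` with `7/10 ≤ |z| ≤ R` not excluded at BOTH ends (`|z − a₁e₃| ≥ 7/10 ∨ |z − a₂e₃| ≥ 7/10`);
C2box MAJORANT at both ends (`frameWeight c a₁ z ≤ wt i ∧ frameWeight c a₂ z ≤ wt i`); C3–C5 verbatim as in `CellCert.Valid`. [line vocabulary · LoopTunnelDial contact dial · crux stmt-AtomisticToContinuum-27294 · definition, not a cited fact] -/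
def CellCert.BoxValid (C : CellCert) (c a₁ a₂ R : ℝ) : Prop :=
  (∀ z : E3, (7 : ℝ) / 10 ≤ ‖z‖ → ‖z‖ ≤ R → ((7 : ℝ) / 10 ≤ dist (a₁ • e₃) z ∨ (7 : ℝ) / 10 ≤ dist (a₂ • e₃) z) →
      ∃ i ∈ C.cells, z ∈ C.cell i) ∧
  (∀ i ∈ C.cells, ∀ z ∈ C.cell i, (7 : ℝ) / 10 ≤ ‖z‖ → ‖z‖ ≤ R →
      ((7 : ℝ) / 10 ≤ dist (a₁ • e₃) z ∨ (7 : ℝ) / 10 ≤ dist (a₂ • e₃) z) →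
      frameWeight c a₁ z ≤ C.wt i ∧ frameWeight c a₂ z ≤ C.wt i) ∧
  (∀ K ∈ C.cliques, ∀ i ∈ K, ∀ j ∈ K, ∀ z ∈ C.cell i, ∀ z' ∈ C.cell j, dist z z' < 7 / 10) ∧
  (∀ i ∈ C.cells, C.wt i ≤ ∑ K ∈ C.cliques.filter (fun K => i ∈ K), C.y K) ∧
  (∀ K ∈ C.cliques, 0 ≤ C.y K)

/-- **a-BOX SOUNDNESS (PROVED):** a box-valid certificate is valid (for the negated priced weight) at EVERY `a ∈ [a₁, a₂]`. -/
theorem CellCert.valid_of_boxValid (C : CellCert) {c a₁ a₂ a R : ℝ} (hV : C.BoxValid c a₁ a₂ R)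
    (h₁ : a₁ ≤ a) (h₂ : a ≤ a₂) :
    C.Valid 0 (a • e₃) R (fun z => -pricedTerm c 0 (a • e₃) z) := by
  obtain ⟨hcover, hwt, hcl, hdual, hy⟩ := hV
  have hadm : ∀ z, Admissible 0 (a • e₃) R z →
      (7 : ℝ) / 10 ≤ ‖z‖ ∧ ‖z‖ ≤ R ∧ ((7 : ℝ) / 10 ≤ dist (a₁ • e₃) z ∨ (7 : ℝ) / 10 ≤ dist (a₂ • e₃) z) := by
    rintro z ⟨hz1, hz2, hz3⟩
    rw [dist_zero_left] at hz1 hz2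
    exact ⟨hz1, hz2, le_max_iff.1 (hz3.trans (dist_smul_e₃_le_max h₁ h₂ z))⟩
  refine ⟨fun z hz => ?_, fun i hi z hzi hz => ?_, hcl, hdual, hy⟩
  · obtain ⟨h7, hR, hor⟩ := hadm z hz
    exact hcover z h7 hR hor
  · obtain ⟨h7, hR, hor⟩ := hadm z hz
    obtain ⟨hw1, hw2⟩ := hwt i hi z hzi h7 hR hor
    show -pricedTerm c 0 (a • e₃) z ≤ C.wt i
    rw [neg_pricedTerm_frame]
    exact (frameWeight_le_max h₁ h₂ z).trans (max_le hw1 hw2)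

/-- FORMAT SANITY (PROVED): `BoxValid` is NOT vacuous — the empty certificate fails the cover C1 as soon as `R ≥ 7/10` (`a₁ ≥ 0`): the point
`−(7/10)·e₃` (`|z| = 7/10`, `|z − a₁e₃| = a₁ + 7/10`) must be covered.  (Compare `CellCert.empty_valid` of kit 14: valid below range `7/10`.) -/
theorem CellCert.empty_not_boxValid {c a₁ a₂ R : ℝ} (ha : 0 ≤ a₁) (hR : (7 : ℝ) / 10 ≤ R) :
    ¬ CellCert.empty.BoxValid c a₁ a₂ R := by
  intro h
  have hn : ‖(-(7 / 10 : ℝ)) • e₃‖ = 7 / 10 := by rw [norm_smul_e₃]; norm_num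
  have hd : (7 : ℝ) / 10 ≤ dist (a₁ • e₃) ((-(7 / 10 : ℝ)) • e₃) := by
    rw [dist_eq_norm, ← sub_smul, norm_smul_e₃, abs_of_nonneg (by linarith)]
    linarith
  obtain ⟨i, hi, -⟩ := h.1 _ (by rw [hn]) (by rw [hn]; exact hR) (Or.inl hd)
  simp [CellCert.empty] at hi

/-- **FINITELY MANY a-BOXES GIVE THE FINITE PRICED CAPACITY (PROVED):** breakpoints `b 0 ≤ 7/10`, `ρ ≤ b m` (no monotonicity needed) and one
box-valid certificate with `bound ≤ Λ` per consecutive pair. -/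
theorem finPricedLoadCap_of_boxCerts {ρ c Λ R : ℝ} (b : ℕ → ℝ) (m : ℕ) (hm : 0 < m) (hb0 : b 0 ≤ 7 / 10) (hbm : ρ ≤ b m)
    (h : ∀ j < m, ∃ C : CellCert, C.BoxValid c (b j) (b (j + 1)) R ∧ C.bound ≤ Λ) :
    FinPricedLoadCap ρ c Λ R := by
  refine finPricedLoadCap_of_frame_certs fun a h7 hρ => ?_
  obtain ⟨j, hj, hja⟩ :=
    Literature.Computation.Certificates.BoxCovering.exists_Icc_succ_of_mem_Icc hm (hb0.trans h7) (hρ.le.trans hbm)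
  obtain ⟨C, hV, hbd⟩ := h j hj
  exact ⟨C, C.valid_of_boxValid hV hja.1 hja.2, hbd⟩

/-- **THE STATEMENT CENSUS'S TAG 129′(δ) OUTPUT MUST MEET (PROVED modulo `e⋆ ≤ −0.711`):** a finite list of a-boxes covering `[7/10, 3/4]`
and per box ONE box-valid `CellCert` at price `8/125`, range `5`, with `bound ≤ 77/20`, gives `ContactHotAbove (3/4)` = stub 3 `HOT`. -/
theorem contactHotAbove_threeQuarters_of_boxCerts5 (he : eStar ≤ -(711 / 1000)) (b : ℕ → ℝ) (m : ℕ) (hm : 0 < m)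
    (hb0 : b 0 ≤ 7 / 10) (hbm : 3 / 4 ≤ b m)
    (h : ∀ j < m, ∃ C : CellCert, C.BoxValid (8 / 125) (b j) (b (j + 1)) 5 ∧ C.bound ≤ 77 / 20) :
    ContactHotAbove (3 / 4) :=
  contactHotAbove_threeQuarters_of_finPriced5 he (finPricedLoadCap_of_boxCerts b m hm hb0 hbm h)

end Summit.AtomisticToContinuum.Crystallization.Theorems.LoopTunnelDialForcePricing

end
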